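import Summits.QuantumFields.BalabanUV.Beta.CombHId2Torus

/-!
# `BalabanUV.Beta.CombHId2Folds` — binder row D1 (OWNER an2), (J-a) dictionary, (C2) at ORDER 2, PART THREE (letters, 2a): **THE FOLDS — THE NESTED WORDS OVER
# DOUBLY PERIODIC FAMILIES READ ON THE BOX × BOX, AND THEIR TORUS MATRICES AS FINITE DOUBLE COLUMN-WEIGHTED SUMS**

WHY.  At the junction with the door (leaf-05 `FP/CoarseJetOrderTwoGradedComb`, monomials `Θᴸ·H₂·Θ`, `Ŝ·Q₁₂·Θ`, `Θᴸ·Q₁₂ᵀ·Ŝ`) the nested words of `W2OfK` over the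
periodised tables are `vertex2OfK K N S₂^{per,csf} b b′` and `mixOfK K N M₂^{per,cs} b b′` (PART TWO-c).  The KEY FACT bought by PART TWO (`CombHId2Torus` §6): the inner
families carry `dper` INSIDE, so they are EXACTLY periodic in BOTH bonds — the inner one by the copy sum, the outer one by the joint block covariance.  Hence BOTH
column sums fold onto the box INDEPENDENTLY by `CombHId2Torus` §5 — no convolution coupling between the two period sums (the worry one has for the raw lattice word
does not arise) —, and the torus matrix of each nested word is a FINITE double sum of the family's torus matrices weighted by two torus-column entries of `Â := perF M K`:
the shape in which `H₂` ∕ `Q₁₂` bind them.  This file states the folds for an ABSTRACT doubly periodic bounded (resp. decaying) family; the record's families are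
substituted in the sequel (`S₂^{per,csf}`: `CombHId2Torus.dper_tsum_csf_translate_outer` + `tsum_csf_translate_inner`; `M₂^{per,cs}` likewise).
WHAT ([folklore]; 0 `def`, 0 cited fact, 0 `def … : Prop`, 0 sorry): §1 `abs_vertexOfK_le_of_periodic` (the inner fold's crude bound), **`vertex2OfK_apply_of_periodic₂`**
(`vertex2OfK K N T₂ μ y ν y′ x z a b = Σ_{u,κ} Σ_{u′,κ′} perZ M K u (N•y) (inl κ) (inr μ) · perZ M K u′ (N•y′) (inl κ′) (inr ν) · T₂ κ u κ′ u′ x z a b` for `T₂` exactly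
`M`-periodic in both bonds and bounded), `abs_le_of_decays'`, **`perF_vertex2OfK_of_periodic₂`** (the same for the torus matrices, `T₂` decaying entrywise);
§2 `abs_vertexOfM_le_of_periodic`, **`mixOfK_apply_of_periodic₂`** (`mixOfK K N T μ y ν y′ x z a b = Σ_{u,κ} Σ_{w ∈ pbox M′, ρ} perZ M K u (N•y) (inl κ) (inr μ) ·
perZ M K (N•w) (N•y′) (inr ρ) (inr ν) · T κ u ρ w x z a b`, `T` exactly `M`-periodic in the fine bond and `M′`-periodic in the coarse one), **`perF_mixOfK_of_periodic₂`**;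
§3 the torus readings of the weights BY NAME (`perZ_coarse_col_eq_perF`, `perZ_coarse_coarse_eq_perF`): **`perF_vertex2OfK_of_periodic₂'`**, **`perF_mixOfK_of_periodic₂'`**
(the weights as entries of `perF M K` — `Θ`-columns for the fine slots, `Ŝ`-columns for the coarse slot); §4 `decays_vertex2OfK_of_periodic₂`,
`decays_mixOfK_of_periodic₂` (the nested words decay — the summability currency `perF_add` needs to split `W2OfK` on the torus).
NOT HERE: the substitution of the record's `S₂^{per,csf}` ∕ `M₂^{per,cs}` (sequel, on PART TWO-c's `biLoc_S₂_csf` ∕ `biLoc_M₂_cs`), the response word and `K3OfK` ∕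
`e4OfKW` on the torus (`CombHId2TorusWords`), the torus algebra against leaf-05 §1 (leaf-05's junction cert); nothing of Bałaban's asserted; NOT D1, NEVER «G-an2-4
closed», NOT BetaPertH, NOT continuum, NOT Clay.

HONEST DEPENDENCY (page 1, mandatory): continuum YM on T⁴ ⇐ BetaPertH ∧ nine spine estimates (0/9 proved); BetaPertH ⇐ (D1) ∧ (D4) ∧ CAP+tail;
G-an2-4 gates asym, D1 and NE2/3/4.  HONEST FRAMING (cell contract, verbatim): «discharging `BetaPertH` makes Bałaban's UV stability UNCONDITIONAL —
a real constructive-QFT result; it is NOT the continuum limit and NOT the Clay problem.»  ABSOLUTE RULE (cell charter, verbatim): «No internally-minted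
statement may enter as a cited fact. Every hypothesis is either kernel-proved in this package or a verbatim quotation of a PUBLISHED theorem with page
reference. The manuscript(s) under audit are NOT citable for their own disputed steps — they are the thing under adjudication; programme-internal
(2001/route/tribunal) claims are never citable.»  Row D1 OWNER an2 (b2b-balaban-beta-an2) gen 45, 2026-08-23; over `CombHId2Torus` §5, C2a, C2b and `FP.KernelPeriodisationFib` BY NAME.
-/

noncomputable section

open scoped BigOperators Matrix

namespace Summit.QuantumFields.BalabanUV.Beta.CombHId2Folds

open Literature.MathematicalPhysics.QuantumFieldTheory.Balaban1983to89
open Literature.MathematicalPhysics.QuantumFieldTheory.Balaban1983to89.Beta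
open B4TorusKernel.MultiPeriod (translate translate_apply)
open ExpKernelCalculus (MKer Decays BiLoc VertexFamily comp)
open AffineAveraging (Site)
open OneStepResolventKernel (Fib)
open SecondOrderResponse (vertexOfM vertex2OfK mixOfK)
open Summit.QuantumFields.BalabanUV.Beta.FP.KernelPeriodisationFib (Idx perF perZ perF_apply perZ_apply summable_translate_of_decays)
open Summit.QuantumFields.BalabanUV.Beta.FP.TorusGaugeCovariancePairing (wrapPt wrapPt_coe)
open Summit.QuantumFields.BalabanUV.Beta.CombHId1Letters (abs_perZ_le_of_decays perZ_coarse_col_eq_perF)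
open B12Sec2to5 (l1 l1_nonneg)
open B4Sect5Proof (latticeConst latticeConst_nonneg)
open B6Lemma24Torus (pbox)
open OneStepKernelFamily (vertexOfK)
open Summit.QuantumFields.BalabanUV.Beta.CombHId2Torus (vertexOfK_apply_of_periodic vertexOfM_apply_of_periodic perZ_coarse_coarse_eq_perF)

variable {d : ℕ} (M : Fin (d + 1) → ℕ) [∀ μ, NeZero (M μ)] {N : ℕ} [NeZero N] {M' : Fin (d + 1) → ℕ} {K : MKer (d + 1) (Fib d)} {CK δK : ℝ}

/-! ## §1 The bi-vertex over a family EXACTLY periodic in both fine bonds, read on the box × box -/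

section Vertex2

variable {T₂ : Fin (d + 1) → Site (d + 1) → Fin (d + 1) → Site (d + 1) → MKer (d + 1) (Fib d)}

omit [NeZero N] in
/-- [folklore] the crude bound of the inner fold: for `T` exactly `M`-periodic and bounded by `B`,
`|vertexOfK K N T ν y′ x z a b| ≤ Σ_{u′ ∈ pbox M} Σ_{κ′} C_K·K_{d+1}(δ_K)·B` (`CombHId2Torus.vertexOfK_apply_of_periodic` + C2a `abs_perZ_le_of_decays`). -/
theorem abs_vertexOfK_le_of_periodic
    (hKinv : ∀ (m x z : Site (d + 1)) (a b : Fib d), K (translate M x m) (translate M z m) a b = K x z a b)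
    (hK : Decays K CK δK) (hδK : 0 < δK)
    {T : Fin (d + 1) → Site (d + 1) → MKer (d + 1) (Fib d)} (hTper : ∀ (κ : Fin (d + 1)) (u m : Site (d + 1)), T κ (translate M u m) = T κ u)
    {B : ℝ} (hTB : ∀ (κ : Fin (d + 1)) (u x z : Site (d + 1)) (a b : Fib d), |T κ u x z a b| ≤ B)
    (ν : Fin (d + 1)) (y' x z : Site (d + 1)) (a b : Fib d) :
    |vertexOfK K N T ν y' x z a b| ≤ ∑ _u' : ↥(pbox M), ∑ _κ' : Fin (d + 1), CK * latticeConst (d + 1) δK * B := by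
  have hCK : 0 ≤ CK := hK.nonneg (Sum.inl 0)
  rw [vertexOfK_apply_of_periodic M hKinv hK hδK hTper hTB]
  refine (Finset.abs_sum_le_sum_abs _ _).trans (Finset.sum_le_sum fun u' _ => ?_)
  refine (Finset.abs_sum_le_sum_abs _ _).trans (Finset.sum_le_sum fun κ' _ => ?_)
  rw [abs_mul]
  exact mul_le_mul (abs_perZ_le_of_decays M hK hCK hδK _ _ _ _) (hTB κ' _ x z a b) (abs_nonneg _)
    (mul_nonneg hCK (latticeConst_nonneg (d + 1) hδK.le))

omit [NeZero N] in
/-- [folklore] **THE BI-VERTEX OVER A DOUBLY PERIODIC BOUNDED FAMILY, READ ON THE BOX × BOX**: for `T₂ κ (u + M∘m) κ′ u′ = T₂ κ u κ′ u′`,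
`T₂ κ u κ′ (u′ + M∘m) = T₂ κ u κ′ u′` and `|T₂ κ u κ′ u′ x z a b| ≤ B`,
`vertex2OfK K N T₂ μ y ν y′ x z a b = Σ_{u ∈ pbox M} Σ_κ Σ_{u′ ∈ pbox M} Σ_{κ′} perZ M K u (N•y) (inl κ) (inr μ) · (perZ M K u′ (N•y′) (inl κ′) (inr ν) · T₂ κ u κ′ u′ x z a b)`
— `CombHId2Torus.vertexOfK_apply_of_periodic` TWICE: the outer family `κ u ↦ vertexOfK K N (T₂ κ u) ν y′` is exactly periodic (by the outer periodicity of `T₂`) and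
bounded (`abs_vertexOfK_le_of_periodic`); NO coupling between the two period sums. -/
theorem vertex2OfK_apply_of_periodic₂
    (hKinv : ∀ (m x z : Site (d + 1)) (a b : Fib d), K (translate M x m) (translate M z m) a b = K x z a b)
    (hK : Decays K CK δK) (hδK : 0 < δK)
    (hTo : ∀ (κ : Fin (d + 1)) (u m : Site (d + 1)), T₂ κ (translate M u m) = T₂ κ u)
    (hTi : ∀ (κ : Fin (d + 1)) (u : Site (d + 1)) (κ' : Fin (d + 1)) (u' m : Site (d + 1)), T₂ κ u κ' (translate M u' m) = T₂ κ u κ' u')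
    {B : ℝ} (hTB : ∀ (κ : Fin (d + 1)) (u : Site (d + 1)) (κ' : Fin (d + 1)) (u' x z : Site (d + 1)) (a b : Fib d), |T₂ κ u κ' u' x z a b| ≤ B)
    (μ : Fin (d + 1)) (y : Site (d + 1)) (ν : Fin (d + 1)) (y' x z : Site (d + 1)) (a b : Fib d) :
    vertex2OfK K N T₂ μ y ν y' x z a b
      = ∑ u : ↥(pbox M), ∑ κ : Fin (d + 1), ∑ u' : ↥(pbox M), ∑ κ' : Fin (d + 1),
          perZ M K (u : Site (d + 1)) ((N : ℤ) • y) (Sum.inl κ) (Sum.inr μ)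
            * (perZ M K (u' : Site (d + 1)) ((N : ℤ) • y') (Sum.inl κ') (Sum.inr ν) * T₂ κ (u : Site (d + 1)) κ' (u' : Site (d + 1)) x z a b) := by
  have hper : ∀ (κ : Fin (d + 1)) (u m : Site (d + 1)),
      (fun κ u => vertexOfK K N (T₂ κ u) ν y') κ (translate M u m) = (fun κ u => vertexOfK K N (T₂ κ u) ν y') κ u := by
    intro κ u m
    show vertexOfK K N (T₂ κ (translate M u m)) ν y' = vertexOfK K N (T₂ κ u) ν y'
    rw [hTo]
  have hbd : ∀ (κ : Fin (d + 1)) (u x z : Site (d + 1)) (a b : Fib d),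
      |(fun κ u => vertexOfK K N (T₂ κ u) ν y') κ u x z a b| ≤ ∑ _u' : ↥(pbox M), ∑ _κ' : Fin (d + 1), CK * latticeConst (d + 1) δK * B :=
    fun κ u x z a b => abs_vertexOfK_le_of_periodic M hKinv hK hδK (hTi κ u) (hTB κ u) ν y' x z a b
  unfold vertex2OfK
  rw [vertexOfK_apply_of_periodic M hKinv hK hδK hper hbd]
  refine Finset.sum_congr rfl fun u _ => Finset.sum_congr rfl fun κ _ => ?_
  show perZ M K (u : Site (d + 1)) ((N : ℤ) • y) (Sum.inl κ) (Sum.inr μ) * vertexOfK K N (T₂ κ (u : Site (d + 1))) ν y' x z a b = _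
  rw [vertexOfK_apply_of_periodic M hKinv hK hδK (hTi κ _) (hTB κ _) ν y' x z a b, Finset.mul_sum]
  refine Finset.sum_congr rfl fun u' _ => ?_
  rw [Finset.mul_sum]

omit [∀ μ, NeZero (M μ)] [NeZero N] in
/-- [folklore] a decaying kernel is bounded by its constant. -/
theorem abs_le_of_decays' {X : MKer (d + 1) (Fib d)} {C δ : ℝ} (hX : Decays X C δ) (hδ : 0 ≤ δ) (x z : Site (d + 1)) (a b : Fib d) :
    |X x z a b| ≤ C := by
  refine (hX x z a b).trans ?_
  have h1 : Real.exp (-δ * l1 (x - z)) ≤ 1 := by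
    rw [Real.exp_le_one_iff]; exact mul_nonpos_of_nonpos_of_nonneg (neg_nonpos.2 hδ) (l1_nonneg _)
  calc C * Real.exp (-δ * l1 (x - z)) ≤ C * 1 := mul_le_mul_of_nonneg_left h1 (hX.nonneg (Sum.inl 0))
    _ = C := mul_one C

omit [NeZero N] in
/-- [folklore] **THE TORUS MATRIX OF THE BI-VERTEX OVER A DOUBLY PERIODIC DECAYING FAMILY AS A FINITE DOUBLE COLUMN-WEIGHTED SUM**:
`perF M (vertex2OfK K N T₂ μ y ν y′) P Q = Σ_{u,κ} Σ_{u′,κ′} perZ M K u (N•y) (inl κ) (inr μ) · (perZ M K u′ (N•y′) (inl κ′) (inr ν) · perF M (T₂ κ u κ′ u′) P Q)` (§1 under the period sum;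
term-wise summability from the entrywise decay — `FP.KernelPeriodisationFib.summable_translate_of_decays`). -/
theorem perF_vertex2OfK_of_periodic₂
    (hKinv : ∀ (m x z : Site (d + 1)) (a b : Fib d), K (translate M x m) (translate M z m) a b = K x z a b)
    (hK : Decays K CK δK) (hδK : 0 < δK)
    (hTo : ∀ (κ : Fin (d + 1)) (u m : Site (d + 1)), T₂ κ (translate M u m) = T₂ κ u)
    (hTi : ∀ (κ : Fin (d + 1)) (u : Site (d + 1)) (κ' : Fin (d + 1)) (u' m : Site (d + 1)), T₂ κ u κ' (translate M u' m) = T₂ κ u κ' u')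
    {CT δT : ℝ} (hTd : ∀ (κ : Fin (d + 1)) (u : Site (d + 1)) (κ' : Fin (d + 1)) (u' : Site (d + 1)), Decays (T₂ κ u κ' u') CT δT) (hδT : 0 < δT)
    (μ : Fin (d + 1)) (y : Site (d + 1)) (ν : Fin (d + 1)) (y' : Site (d + 1)) (P Q : Idx M (Fib d)) :
    perF M (vertex2OfK K N T₂ μ y ν y') P Q
      = ∑ u : ↥(pbox M), ∑ κ : Fin (d + 1), ∑ u' : ↥(pbox M), ∑ κ' : Fin (d + 1),
          perZ M K (u : Site (d + 1)) ((N : ℤ) • y) (Sum.inl κ) (Sum.inr μ)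
            * (perZ M K (u' : Site (d + 1)) ((N : ℤ) • y') (Sum.inl κ') (Sum.inr ν) * perF M (T₂ κ (u : Site (d + 1)) κ' (u' : Site (d + 1))) P Q) := by
  have hCT : 0 ≤ CT := (hTd 0 0 0 0).nonneg (Sum.inl 0)
  have hTB : ∀ (κ : Fin (d + 1)) (u : Site (d + 1)) (κ' : Fin (d + 1)) (u' x z : Site (d + 1)) (a b : Fib d), |T₂ κ u κ' u' x z a b| ≤ CT :=
    fun κ u κ' u' x z a b => abs_le_of_decays' (hTd κ u κ' u') hδT.le x z a b
  have hM1 : ∀ i, 1 ≤ M i := fun i => Nat.one_le_iff_ne_zero.mpr (NeZero.ne (M i))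
  have hsum : ∀ (κ : Fin (d + 1)) (u : Site (d + 1)) (κ' : Fin (d + 1)) (u' : Site (d + 1)),
      Summable fun n : Site (d + 1) => T₂ κ u κ' u' P.1 (translate M Q.1 n) P.2 Q.2 :=
    fun κ u κ' u' => summable_translate_of_decays (hTd κ u κ' u') hCT hδT hM1 _ _ _ _
  rw [perF_apply, perZ_apply]
  simp only [vertex2OfK_apply_of_periodic₂ M hKinv hK hδK hTo hTi hTB]
  rw [Summable.tsum_finsetSum (fun u _ => summable_sum fun κ _ => summable_sum fun u' _ => summable_sum fun κ' _ =>
    ((hsum κ _ κ' _).mul_left _).mul_left _)]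
  refine Finset.sum_congr rfl fun u _ => ?_
  rw [Summable.tsum_finsetSum (fun κ _ => summable_sum fun u' _ => summable_sum fun κ' _ => ((hsum κ _ κ' _).mul_left _).mul_left _)]
  refine Finset.sum_congr rfl fun κ _ => ?_
  rw [Summable.tsum_finsetSum (fun u' _ => summable_sum fun κ' _ => ((hsum κ _ κ' _).mul_left _).mul_left _)]
  refine Finset.sum_congr rfl fun u' _ => ?_
  rw [Summable.tsum_finsetSum (fun κ' _ => ((hsum κ _ κ' _).mul_left _).mul_left _)]
  refine Finset.sum_congr rfl fun κ' _ => ?_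
  rw [tsum_mul_left, tsum_mul_left, perF_apply, perZ_apply M (T₂ κ (u : Site (d + 1)) κ' (u' : Site (d + 1)))]

end Vertex2

/-! ## §2 The mixed bi-vertex over a family EXACTLY periodic in the fine bond and in the coarse bond, read on the box × coarse box -/

section Mix

variable {T : Fin (d + 1) → Site (d + 1) → Fin (d + 1) → Site (d + 1) → MKer (d + 1) (Fib d)}

omit [∀ μ, NeZero (M μ)] in
/-- [folklore] the crude bound of the inner coarse fold: for `G` exactly `M′`-periodic and bounded by `B` (`M = N·M′`),
`|vertexOfM K N G ν y′ x z a b| ≤ Σ_{w ∈ pbox M′} Σ_ρ C_K·K_{d+1}(δ_K)·B`. -/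
theorem abs_vertexOfM_le_of_periodic [∀ μ, NeZero (M' μ)] (hM : ∀ i, M i = N * M' i)
    (hKinv : ∀ (m x z : Site (d + 1)) (a b : Fib d), K (translate M x m) (translate M z m) a b = K x z a b)
    (hK : Decays K CK δK) (hδK : 0 < δK)
    {G : Fin (d + 1) → Site (d + 1) → MKer (d + 1) (Fib d)} (hGper : ∀ (ρ : Fin (d + 1)) (w m : Site (d + 1)), G ρ (translate M' w m) = G ρ w)
    {B : ℝ} (hGB : ∀ (ρ : Fin (d + 1)) (w x z : Site (d + 1)) (a b : Fib d), |G ρ w x z a b| ≤ B)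
    (ν : Fin (d + 1)) (y' x z : Site (d + 1)) (a b : Fib d) :
    |vertexOfM K N G ν y' x z a b| ≤ ∑ _w : ↥(pbox M'), ∑ _ρ : Fin (d + 1), CK * latticeConst (d + 1) δK * B := by
  haveI : ∀ μ, NeZero (M μ) := fun μ => ⟨by rw [hM]; exact mul_ne_zero (NeZero.ne N) (NeZero.ne (M' μ))⟩
  have hCK : 0 ≤ CK := hK.nonneg (Sum.inl 0)
  rw [vertexOfM_apply_of_periodic M hM hKinv hK hδK hGper hGB]
  refine (Finset.abs_sum_le_sum_abs _ _).trans (Finset.sum_le_sum fun w _ => ?_)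
  refine (Finset.abs_sum_le_sum_abs _ _).trans (Finset.sum_le_sum fun ρ _ => ?_)
  rw [abs_mul]
  exact mul_le_mul (abs_perZ_le_of_decays M hK hCK hδK _ _ _ _) (hGB ρ _ x z a b) (abs_nonneg _)
    (mul_nonneg hCK (latticeConst_nonneg (d + 1) hδK.le))

/-- [folklore] **THE MIXED BI-VERTEX OVER A FAMILY EXACTLY `M`-PERIODIC IN THE FINE BOND AND `M′`-PERIODIC IN THE COARSE ONE, READ ON THE BOX × COARSE BOX**
(`M = N·M′`): for `T κ (u + M∘m) = T κ u`, `T κ u ρ (w + M′∘m) = T κ u ρ w` and `|T κ u ρ w x z a b| ≤ B`,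
`mixOfK K N T μ y ν y′ x z a b = Σ_{u ∈ pbox M} Σ_κ Σ_{w ∈ pbox M′} Σ_ρ perZ M K u (N•y) (inl κ) (inr μ) · (perZ M K (N•w) (N•y′) (inr ρ) (inr ν) · T κ u ρ w x z a b)`
(`CombHId2Torus.vertexOfK_apply_of_periodic` outside, `vertexOfM_apply_of_periodic` inside). -/
theorem mixOfK_apply_of_periodic₂ [∀ μ, NeZero (M' μ)] (hM : ∀ i, M i = N * M' i)
    (hKinv : ∀ (m x z : Site (d + 1)) (a b : Fib d), K (translate M x m) (translate M z m) a b = K x z a b)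
    (hK : Decays K CK δK) (hδK : 0 < δK)
    (hTo : ∀ (κ : Fin (d + 1)) (u m : Site (d + 1)), T κ (translate M u m) = T κ u)
    (hTi : ∀ (κ : Fin (d + 1)) (u : Site (d + 1)) (ρ : Fin (d + 1)) (w m : Site (d + 1)), T κ u ρ (translate M' w m) = T κ u ρ w)
    {B : ℝ} (hTB : ∀ (κ : Fin (d + 1)) (u : Site (d + 1)) (ρ : Fin (d + 1)) (w x z : Site (d + 1)) (a b : Fib d), |T κ u ρ w x z a b| ≤ B)
    (μ : Fin (d + 1)) (y : Site (d + 1)) (ν : Fin (d + 1)) (y' x z : Site (d + 1)) (a b : Fib d) :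
    mixOfK K N T μ y ν y' x z a b
      = ∑ u : ↥(pbox M), ∑ κ : Fin (d + 1), ∑ w : ↥(pbox M'), ∑ ρ : Fin (d + 1),
          perZ M K (u : Site (d + 1)) ((N : ℤ) • y) (Sum.inl κ) (Sum.inr μ)
            * (perZ M K ((N : ℤ) • (w : Site (d + 1))) ((N : ℤ) • y') (Sum.inr ρ) (Sum.inr ν) * T κ (u : Site (d + 1)) ρ (w : Site (d + 1)) x z a b) := by
  have hper : ∀ (κ : Fin (d + 1)) (u m : Site (d + 1)),
      (fun κ u => vertexOfM K N (T κ u) ν y') κ (translate M u m) = (fun κ u => vertexOfM K N (T κ u) ν y') κ u := by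
    intro κ u m
    show vertexOfM K N (T κ (translate M u m)) ν y' = vertexOfM K N (T κ u) ν y'
    rw [hTo]
  have hbd : ∀ (κ : Fin (d + 1)) (u x z : Site (d + 1)) (a b : Fib d),
      |(fun κ u => vertexOfM K N (T κ u) ν y') κ u x z a b| ≤ ∑ _w : ↥(pbox M'), ∑ _ρ : Fin (d + 1), CK * latticeConst (d + 1) δK * B :=
    fun κ u x z a b => abs_vertexOfM_le_of_periodic M hM hKinv hK hδK (hTi κ u) (hTB κ u) ν y' x z a b
  unfold mixOfK
  rw [vertexOfK_apply_of_periodic M hKinv hK hδK hper hbd]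
  refine Finset.sum_congr rfl fun u _ => Finset.sum_congr rfl fun κ _ => ?_
  show perZ M K (u : Site (d + 1)) ((N : ℤ) • y) (Sum.inl κ) (Sum.inr μ) * vertexOfM K N (T κ (u : Site (d + 1))) ν y' x z a b = _
  rw [vertexOfM_apply_of_periodic M hM hKinv hK hδK (hTi κ _) (hTB κ _) ν y' x z a b, Finset.mul_sum]
  refine Finset.sum_congr rfl fun w _ => ?_
  rw [Finset.mul_sum]

/-- [folklore] **THE TORUS MATRIX OF THE MIXED BI-VERTEX OVER A DOUBLY PERIODIC DECAYING FAMILY AS A FINITE DOUBLE COLUMN-WEIGHTED SUM**: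
`perF M (mixOfK K N T μ y ν y′) P Q = Σ_{u,κ} Σ_{w,ρ} perZ M K u (N•y) (inl κ) (inr μ) · (perZ M K (N•w) (N•y′) (inr ρ) (inr ν) · perF M (T κ u ρ w) P Q)`. -/
theorem perF_mixOfK_of_periodic₂ [∀ μ, NeZero (M' μ)] (hM : ∀ i, M i = N * M' i)
    (hKinv : ∀ (m x z : Site (d + 1)) (a b : Fib d), K (translate M x m) (translate M z m) a b = K x z a b)
    (hK : Decays K CK δK) (hδK : 0 < δK)
    (hTo : ∀ (κ : Fin (d + 1)) (u m : Site (d + 1)), T κ (translate M u m) = T κ u)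
    (hTi : ∀ (κ : Fin (d + 1)) (u : Site (d + 1)) (ρ : Fin (d + 1)) (w m : Site (d + 1)), T κ u ρ (translate M' w m) = T κ u ρ w)
    {CT δT : ℝ} (hTd : ∀ (κ : Fin (d + 1)) (u : Site (d + 1)) (ρ : Fin (d + 1)) (w : Site (d + 1)), Decays (T κ u ρ w) CT δT) (hδT : 0 < δT)
    (μ : Fin (d + 1)) (y : Site (d + 1)) (ν : Fin (d + 1)) (y' : Site (d + 1)) (P Q : Idx M (Fib d)) :
    perF M (mixOfK K N T μ y ν y') P Q
      = ∑ u : ↥(pbox M), ∑ κ : Fin (d + 1), ∑ w : ↥(pbox M'), ∑ ρ : Fin (d + 1),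
          perZ M K (u : Site (d + 1)) ((N : ℤ) • y) (Sum.inl κ) (Sum.inr μ)
            * (perZ M K ((N : ℤ) • (w : Site (d + 1))) ((N : ℤ) • y') (Sum.inr ρ) (Sum.inr ν) * perF M (T κ (u : Site (d + 1)) ρ (w : Site (d + 1))) P Q) := by
  have hCT : 0 ≤ CT := (hTd 0 0 0 0).nonneg (Sum.inl 0)
  have hTB : ∀ (κ : Fin (d + 1)) (u : Site (d + 1)) (ρ : Fin (d + 1)) (w x z : Site (d + 1)) (a b : Fib d), |T κ u ρ w x z a b| ≤ CT :=
    fun κ u ρ w x z a b => abs_le_of_decays' (hTd κ u ρ w) hδT.le x z a b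
  have hM1 : ∀ i, 1 ≤ M i := fun i => Nat.one_le_iff_ne_zero.mpr (NeZero.ne (M i))
  have hsum : ∀ (κ : Fin (d + 1)) (u : Site (d + 1)) (ρ : Fin (d + 1)) (w : Site (d + 1)),
      Summable fun n : Site (d + 1) => T κ u ρ w P.1 (translate M Q.1 n) P.2 Q.2 :=
    fun κ u ρ w => summable_translate_of_decays (hTd κ u ρ w) hCT hδT hM1 _ _ _ _
  rw [perF_apply, perZ_apply]
  simp only [mixOfK_apply_of_periodic₂ M hM hKinv hK hδK hTo hTi hTB]
  rw [Summable.tsum_finsetSum (fun u _ => summable_sum fun κ _ => summable_sum fun w _ => summable_sum fun ρ _ =>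
    ((hsum κ _ ρ _).mul_left _).mul_left _)]
  refine Finset.sum_congr rfl fun u _ => ?_
  rw [Summable.tsum_finsetSum (fun κ _ => summable_sum fun w _ => summable_sum fun ρ _ => ((hsum κ _ ρ _).mul_left _).mul_left _)]
  refine Finset.sum_congr rfl fun κ _ => ?_
  rw [Summable.tsum_finsetSum (fun w _ => summable_sum fun ρ _ => ((hsum κ _ ρ _).mul_left _).mul_left _)]
  refine Finset.sum_congr rfl fun w _ => ?_
  rw [Summable.tsum_finsetSum (fun ρ _ => ((hsum κ _ ρ _).mul_left _).mul_left _)]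
  refine Finset.sum_congr rfl fun ρ _ => ?_
  rw [tsum_mul_left, tsum_mul_left, perF_apply, perZ_apply M (T κ (u : Site (d + 1)) ρ (w : Site (d + 1)))]

end Mix

/-! ## §3 The weights read as torus-matrix entries of `perF M K` (the door's `Θ` ∕ `Ŝ` columns) -/

section TorusWeights

variable {T₂ : Fin (d + 1) → Site (d + 1) → Fin (d + 1) → Site (d + 1) → MKer (d + 1) (Fib d)}

omit [NeZero N] in
/-- [folklore] **`perF_vertex2OfK_of_periodic₂'` — THE SHAPE IN WHICH THE DOOR's `H₂` BINDS THE BI-VERTEX**: with `Â := perF M K`,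
`perF M (vertex2OfK K N T₂ μ y ν y′) P Q = Σ_{u,κ} Σ_{u′,κ′} Â((u, inl κ), (wrapPt M (N•y), inr μ)) · (Â((u′, inl κ′), (wrapPt M (N•y′), inr ν)) · perF M (T₂ κ u κ′ u′) P Q)` —
two `Θ`-column entries of `Â` against the family's torus matrices (`perF_vertex2OfK_of_periodic₂` + C2a `perZ_coarse_col_eq_perF`). -/
theorem perF_vertex2OfK_of_periodic₂'
    (hKinv : ∀ (m x z : Site (d + 1)) (a b : Fib d), K (translate M x m) (translate M z m) a b = K x z a b)
    (hK : Decays K CK δK) (hδK : 0 < δK)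
    (hTo : ∀ (κ : Fin (d + 1)) (u m : Site (d + 1)), T₂ κ (translate M u m) = T₂ κ u)
    (hTi : ∀ (κ : Fin (d + 1)) (u : Site (d + 1)) (κ' : Fin (d + 1)) (u' m : Site (d + 1)), T₂ κ u κ' (translate M u' m) = T₂ κ u κ' u')
    {CT δT : ℝ} (hTd : ∀ (κ : Fin (d + 1)) (u : Site (d + 1)) (κ' : Fin (d + 1)) (u' : Site (d + 1)), Decays (T₂ κ u κ' u') CT δT) (hδT : 0 < δT)
    (μ : Fin (d + 1)) (y : Site (d + 1)) (ν : Fin (d + 1)) (y' : Site (d + 1)) (P Q : Idx M (Fib d)) :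
    perF M (vertex2OfK K N T₂ μ y ν y') P Q
      = ∑ u : ↥(pbox M), ∑ κ : Fin (d + 1), ∑ u' : ↥(pbox M), ∑ κ' : Fin (d + 1),
          perF M K (u, Sum.inl κ) (wrapPt M ((N : ℤ) • y), Sum.inr μ)
            * (perF M K (u', Sum.inl κ') (wrapPt M ((N : ℤ) • y'), Sum.inr ν) * perF M (T₂ κ (u : Site (d + 1)) κ' (u' : Site (d + 1))) P Q) := by
  rw [perF_vertex2OfK_of_periodic₂ M hKinv hK hδK hTo hTi hTd hδT]
  simp only [perZ_coarse_col_eq_perF]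

variable {T : Fin (d + 1) → Site (d + 1) → Fin (d + 1) → Site (d + 1) → MKer (d + 1) (Fib d)}

/-- [folklore] **`perF_mixOfK_of_periodic₂'` — THE SHAPE IN WHICH THE DOOR's `Q₁₂` BINDS THE MIXED BI-VERTEX**: with `Â := perF M K`,
`perF M (mixOfK K N T μ y ν y′) P Q = Σ_{u,κ} Σ_{w,ρ} Â((u, inl κ), (wrapPt M (N•y), inr μ)) · (Â((wrapPt M (N•w), inr ρ), (wrapPt M (N•y′), inr ν)) · perF M (T κ u ρ w) P Q)` — a
`Θ`-column entry and an `Ŝ`-column entry of `Â` (`perF_mixOfK_of_periodic₂` + C2a `perZ_coarse_col_eq_perF` + `CombHId2Torus.perZ_coarse_coarse_eq_perF`). -/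
theorem perF_mixOfK_of_periodic₂' [∀ μ, NeZero (M' μ)] (hM : ∀ i, M i = N * M' i)
    (hKinv : ∀ (m x z : Site (d + 1)) (a b : Fib d), K (translate M x m) (translate M z m) a b = K x z a b)
    (hK : Decays K CK δK) (hδK : 0 < δK)
    (hTo : ∀ (κ : Fin (d + 1)) (u m : Site (d + 1)), T κ (translate M u m) = T κ u)
    (hTi : ∀ (κ : Fin (d + 1)) (u : Site (d + 1)) (ρ : Fin (d + 1)) (w m : Site (d + 1)), T κ u ρ (translate M' w m) = T κ u ρ w)
    {CT δT : ℝ} (hTd : ∀ (κ : Fin (d + 1)) (u : Site (d + 1)) (ρ : Fin (d + 1)) (w : Site (d + 1)), Decays (T κ u ρ w) CT δT) (hδT : 0 < δT)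
    (μ : Fin (d + 1)) (y : Site (d + 1)) (ν : Fin (d + 1)) (y' : Site (d + 1)) (P Q : Idx M (Fib d)) :
    perF M (mixOfK K N T μ y ν y') P Q
      = ∑ u : ↥(pbox M), ∑ κ : Fin (d + 1), ∑ w : ↥(pbox M'), ∑ ρ : Fin (d + 1),
          perF M K (u, Sum.inl κ) (wrapPt M ((N : ℤ) • y), Sum.inr μ)
            * (perF M K (wrapPt M ((N : ℤ) • (w : Site (d + 1))), Sum.inr ρ) (wrapPt M ((N : ℤ) • y'), Sum.inr ν)
                * perF M (T κ (u : Site (d + 1)) ρ (w : Site (d + 1))) P Q) := by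
  rw [perF_mixOfK_of_periodic₂ M hM hKinv hK hδK hTo hTi hTd hδT]
  simp only [perZ_coarse_col_eq_perF, perZ_coarse_coarse_eq_perF M hKinv]

end TorusWeights

/-! ## §4 The nested words over doubly periodic decaying families decay (the summability currency for `perF_add` on `W2OfK`) -/

section Decay

variable {T₂ : Fin (d + 1) → Site (d + 1) → Fin (d + 1) → Site (d + 1) → MKer (d + 1) (Fib d)}

omit [NeZero N] in
/-- [folklore] the bi-vertex over a doubly periodic, entrywise decaying family decays (a finite sum of decaying kernels with bounded weights — §1 + C2a
`abs_perZ_le_of_decays`; crude constant). -/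
theorem decays_vertex2OfK_of_periodic₂
    (hKinv : ∀ (m x z : Site (d + 1)) (a b : Fib d), K (translate M x m) (translate M z m) a b = K x z a b)
    (hK : Decays K CK δK) (hδK : 0 < δK)
    (hTo : ∀ (κ : Fin (d + 1)) (u m : Site (d + 1)), T₂ κ (translate M u m) = T₂ κ u)
    (hTi : ∀ (κ : Fin (d + 1)) (u : Site (d + 1)) (κ' : Fin (d + 1)) (u' m : Site (d + 1)), T₂ κ u κ' (translate M u' m) = T₂ κ u κ' u')
    {CT δT : ℝ} (hTd : ∀ (κ : Fin (d + 1)) (u : Site (d + 1)) (κ' : Fin (d + 1)) (u' : Site (d + 1)), Decays (T₂ κ u κ' u') CT δT) (hδT : 0 < δT)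
    (μ : Fin (d + 1)) (y : Site (d + 1)) (ν : Fin (d + 1)) (y' : Site (d + 1)) :
    Decays (vertex2OfK K N T₂ μ y ν y')
      (∑ _u : ↥(pbox M), ∑ _κ : Fin (d + 1), ∑ _u' : ↥(pbox M), ∑ _κ' : Fin (d + 1),
        CK * latticeConst (d + 1) δK * (CK * latticeConst (d + 1) δK * CT)) δT := by
  have hCK : 0 ≤ CK := hK.nonneg (Sum.inl 0)
  have hc : 0 ≤ CK * latticeConst (d + 1) δK := mul_nonneg hCK (latticeConst_nonneg (d + 1) hδK.le)
  have hTB : ∀ (κ : Fin (d + 1)) (u : Site (d + 1)) (κ' : Fin (d + 1)) (u' x z : Site (d + 1)) (a b : Fib d), |T₂ κ u κ' u' x z a b| ≤ CT :=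
    fun κ u κ' u' x z a b => abs_le_of_decays' (hTd κ u κ' u') hδT.le x z a b
  intro x z a b
  rw [vertex2OfK_apply_of_periodic₂ M hKinv hK hδK hTo hTi hTB μ y ν y' x z a b]
  simp only [Finset.sum_mul]
  refine (Finset.abs_sum_le_sum_abs _ _).trans (Finset.sum_le_sum fun u _ => ?_)
  refine (Finset.abs_sum_le_sum_abs _ _).trans (Finset.sum_le_sum fun κ _ => ?_)
  refine (Finset.abs_sum_le_sum_abs _ _).trans (Finset.sum_le_sum fun u' _ => ?_)
  refine (Finset.abs_sum_le_sum_abs _ _).trans (Finset.sum_le_sum fun κ' _ => ?_)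
  have h1 := abs_perZ_le_of_decays M hK hCK hδK (u : Site (d + 1)) ((N : ℤ) • y) (Sum.inl κ) (Sum.inr μ)
  have h2 := abs_perZ_le_of_decays M hK hCK hδK (u' : Site (d + 1)) ((N : ℤ) • y') (Sum.inl κ') (Sum.inr ν)
  have h3 := hTd κ (u : Site (d + 1)) κ' (u' : Site (d + 1)) x z a b
  calc |perZ M K (u : Site (d + 1)) ((N : ℤ) • y) (Sum.inl κ) (Sum.inr μ)
          * (perZ M K (u' : Site (d + 1)) ((N : ℤ) • y') (Sum.inl κ') (Sum.inr ν) * T₂ κ (u : Site (d + 1)) κ' (u' : Site (d + 1)) x z a b)|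
        = |perZ M K (u : Site (d + 1)) ((N : ℤ) • y) (Sum.inl κ) (Sum.inr μ)|
            * (|perZ M K (u' : Site (d + 1)) ((N : ℤ) • y') (Sum.inl κ') (Sum.inr ν)| * |T₂ κ (u : Site (d + 1)) κ' (u' : Site (d + 1)) x z a b|) := by
          rw [abs_mul, abs_mul]
    _ ≤ (CK * latticeConst (d + 1) δK) * ((CK * latticeConst (d + 1) δK) * (CT * Real.exp (-δT * l1 (x - z)))) :=
          mul_le_mul h1 (mul_le_mul h2 h3 (abs_nonneg _) hc) (by positivity) hc
    _ = CK * latticeConst (d + 1) δK * (CK * latticeConst (d + 1) δK * CT) * Real.exp (-δT * l1 (x - z)) := by ring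

variable {T : Fin (d + 1) → Site (d + 1) → Fin (d + 1) → Site (d + 1) → MKer (d + 1) (Fib d)}

/-- [folklore] the mixed bi-vertex over a doubly periodic, entrywise decaying family decays (§2 + C2a `abs_perZ_le_of_decays`; crude constant). -/
theorem decays_mixOfK_of_periodic₂ [∀ μ, NeZero (M' μ)] (hM : ∀ i, M i = N * M' i)
    (hKinv : ∀ (m x z : Site (d + 1)) (a b : Fib d), K (translate M x m) (translate M z m) a b = K x z a b)
    (hK : Decays K CK δK) (hδK : 0 < δK)
    (hTo : ∀ (κ : Fin (d + 1)) (u m : Site (d + 1)), T κ (translate M u m) = T κ u)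
    (hTi : ∀ (κ : Fin (d + 1)) (u : Site (d + 1)) (ρ : Fin (d + 1)) (w m : Site (d + 1)), T κ u ρ (translate M' w m) = T κ u ρ w)
    {CT δT : ℝ} (hTd : ∀ (κ : Fin (d + 1)) (u : Site (d + 1)) (ρ : Fin (d + 1)) (w : Site (d + 1)), Decays (T κ u ρ w) CT δT) (hδT : 0 < δT)
    (μ : Fin (d + 1)) (y : Site (d + 1)) (ν : Fin (d + 1)) (y' : Site (d + 1)) :
    Decays (mixOfK K N T μ y ν y')
      (∑ _u : ↥(pbox M), ∑ _κ : Fin (d + 1), ∑ _w : ↥(pbox M'), ∑ _ρ : Fin (d + 1),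
        CK * latticeConst (d + 1) δK * (CK * latticeConst (d + 1) δK * CT)) δT := by
  have hCK : 0 ≤ CK := hK.nonneg (Sum.inl 0)
  have hc : 0 ≤ CK * latticeConst (d + 1) δK := mul_nonneg hCK (latticeConst_nonneg (d + 1) hδK.le)
  have hTB : ∀ (κ : Fin (d + 1)) (u : Site (d + 1)) (ρ : Fin (d + 1)) (w x z : Site (d + 1)) (a b : Fib d), |T κ u ρ w x z a b| ≤ CT :=
    fun κ u ρ w x z a b => abs_le_of_decays' (hTd κ u ρ w) hδT.le x z a b
  intro x z a b
  rw [mixOfK_apply_of_periodic₂ M hM hKinv hK hδK hTo hTi hTB μ y ν y' x z a b]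
  simp only [Finset.sum_mul]
  refine (Finset.abs_sum_le_sum_abs _ _).trans (Finset.sum_le_sum fun u _ => ?_)
  refine (Finset.abs_sum_le_sum_abs _ _).trans (Finset.sum_le_sum fun κ _ => ?_)
  refine (Finset.abs_sum_le_sum_abs _ _).trans (Finset.sum_le_sum fun w _ => ?_)
  refine (Finset.abs_sum_le_sum_abs _ _).trans (Finset.sum_le_sum fun ρ _ => ?_)
  have h1 := abs_perZ_le_of_decays M hK hCK hδK (u : Site (d + 1)) ((N : ℤ) • y) (Sum.inl κ) (Sum.inr μ)
  have h2 := abs_perZ_le_of_decays M hK hCK hδK ((N : ℤ) • (w : Site (d + 1))) ((N : ℤ) • y') (Sum.inr ρ) (Sum.inr ν)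
  have h3 := hTd κ (u : Site (d + 1)) ρ (w : Site (d + 1)) x z a b
  calc |perZ M K (u : Site (d + 1)) ((N : ℤ) • y) (Sum.inl κ) (Sum.inr μ)
          * (perZ M K ((N : ℤ) • (w : Site (d + 1))) ((N : ℤ) • y') (Sum.inr ρ) (Sum.inr ν) * T κ (u : Site (d + 1)) ρ (w : Site (d + 1)) x z a b)|
        = |perZ M K (u : Site (d + 1)) ((N : ℤ) • y) (Sum.inl κ) (Sum.inr μ)|
            * (|perZ M K ((N : ℤ) • (w : Site (d + 1))) ((N : ℤ) • y') (Sum.inr ρ) (Sum.inr ν)| * |T κ (u : Site (d + 1)) ρ (w : Site (d + 1)) x z a b|) := by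
          rw [abs_mul, abs_mul]
    _ ≤ (CK * latticeConst (d + 1) δK) * ((CK * latticeConst (d + 1) δK) * (CT * Real.exp (-δT * l1 (x - z)))) :=
          mul_le_mul h1 (mul_le_mul h2 h3 (abs_nonneg _) hc) (by positivity) hc
    _ = CK * latticeConst (d + 1) δK * (CK * latticeConst (d + 1) δK * CT) * Real.exp (-δT * l1 (x - z)) := by ring

end Decay

end Summit.QuantumFields.BalabanUV.Beta.CombHId2Folds

end
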